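import Summits.ABC.IUTFork.MLFGaloisTFG
import Literature.AnabelianGeometry.AbsoluteAnabelian.AbsTopIThm26SplitModelInstances
import HarnessLib

/-!
# [AbsTopI] Thm 2.6 (ii), general pro-`Σ`-completion form: the binder «`G_k` tfg» discharged

S. Mochizuki, *Topics in Absolute Anabelian Geometry I*, Thm 2.6 (ii) p. 21 (proof p. 23: "`G` is
topologically finitely generated [NSW, Theorem 7.5.10]").  The Literature theorem
`MLFBase.thm26ii_of_isProSigmaCompletion_of_rank` (FACT-LIST F-0247, general form on the model class
of print: `Δ` a pro-`Σ` completion of a finitely generated group, MLF base) carries TWO inputs: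
`hG : IsTopologicallyFinitelyGenerated G` and the printed rank datum `hQ`.  The first is a THEOREM
Summits-side (`FundamentalExtension.isTopologicallyFinitelyGenerated_gal_of_mlfBase`, via Tate's
local Euler–Poincaré characteristic); this PROOF-ONLY file (abc-iut cell, row «LF-ABSTOP F-0247»,
seat abc-iut-L4-d1) plugs it in, leaving ONLY `hQ`.  The three model instances (split /
`χ`-twisted / point) are already unconditional in `AbsTopIThm26ii{SplitModel,ChiTwistedModel,
Point}Instance.lean`.  Classical inputs only; nothing here asserts abc proved or refuted or takes
a side on [IUTchIII] Cor. 3.12; instance ≠ node-level discharge.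
-/

noncomputable section

namespace Summit.ABC.IUTFork

open Literature.AnabelianGeometry.AbsoluteAnabelian
open Literature.AnabelianGeometry.SemiGraphs.SemiGraphOfAnabelioids (IsProSigmaCompletion)

universe u

/-- **[AbsTopI] Thm 2.6 (ii) at every extension with MLF base whose `Δ` is a pro-`Σ` completion of a
finitely generated group, modulo ONLY the printed rank datum** (`hQ`: the excess `δ¹_l(Π) − δ¹_l(G)` is a
constant `m` on `Σ`) — the binder «`G` tfg» of the Literature form discharged.
[cite: MochizukiAbsTopI2012, Thm 2.6 (ii) p.21] -/
theorem thm26ii_of_isProSigmaCompletion_of_rank {E : FundamentalExtension.{0}} (B : E.MLFBase)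
    {Γ : Type u} [Group Γ] [Group.FG Γ] {S : Set ℕ} {ι : Γ →* E.geom}
    (hι : IsProSigmaCompletion S ι)
    (hQ : ∃ m : ℕ, ∀ (l : ℕ) [Fact l.Prime], l ∈ S →
      freeProlRank E.arith l = freeProlRank E.gal l + m) :
    E.Thm26ii B S :=
  FundamentalExtension.MLFBase.thm26ii_of_isProSigmaCompletion_of_rank B hι
    (FundamentalExtension.isTopologicallyFinitelyGenerated_gal_of_mlfBase B) hQ

end Summit.ABC.IUTFork

end
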